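import Summits.ABC.ABC.Theses.RibetTakahashiSplit
import Literature.NumberTheory.EllipticCurves.SzpiroFreyProofs
-- buildfix (bf1-g32) B32-9: comment-only touch to re-dispatch the lane build (prune victim: source 08-16, hub olean removed 22:46Z 08-28; deepest olean-less link under the ACTIVE route RibetTakahashiSplit); declarations byte-identical
/-!
# Glue A of route `RibetTakahashiSplit`: the many-prime valuation product gives
sub-exponential abc in the many-prime regime

`SubexpABCManyPrimes` (item stmt-ABC-1568; a route decl until dropped 2026-08-16, stated below) is
the route's stand-alone milestone: for abc triples with `ω(abc) ≥ 5`, `log c ≤ κ_ε · rad(abc)^ε`.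
As a bare statement it is an OPEN sub-exponential abc bound (known only for `ε > 1/3`, via
Stewart–Yu); the route reaches it from its crux r2 = `ManyPrimeValuationProduct`
(`T(E) = ∏_{p ∥ N} ord_p(Δ_min) ≤ C_ε N^ε` for curves semistable away from `2` with `≥ 4` odd
multiplicative primes). This file proves that implication (the route's glue A,
`SubexpManyPrimesOfValuationProduct`), i.e. the milestone CONDITIONALLY on the crux:
`subexpManyPrimes_of_manyPrimeValuationProduct` (deprecated alias
`subexpABCManyPrimes_of_manyPrimeValuationProduct`) and `subexpManyPrimesOfValuationProduct_proof`
(the route decl of glue A, item stmt-ABC-1570, verbatim). Not here: the crux r2 itself (open: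
Pasten's Conj. 1.14 in geometric form), glues B (`ValuationProductOfCurves`) and C.

## Proof (Frey translation, Bombieri–Gubler Ex. 12.5.10)

For an abc triple take the global minimal Frey model `W₀` of
`Literature.NumberTheory.EllipticCurves.exists_minimal_frey_model` ((12.17) if `16 ∤ abc`, (12.18)
for the arrangement `A ≡ −1 (4)`, `16 ∣ B` otherwise). Then `N ∣ 2¹⁰ rad(abc)` and `rad` is
squarefree, so `p² ∤ N` for odd `p`; every odd `p ∣ abc` divides `Δ(W₀)` but not `c₄(W₀)`, so it is
a multiplicative prime (`f_p = 1`), whence `≥ 4` odd multiplicative primes when `ω(abc) ≥ 5`; and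
`|Δ(W₀)| = |Δ_min|` is `16 (abc)²` resp. `(abc/16)²`, so `v_p(abc) ≤ ord_p(Δ_min)` for odd `p`.
Since every factor of `T(E)` is `≥ f_p ≥ 1`, `v_q(abc) ≤ T(E)` for every odd prime `q`.
Choosing an odd member `n ∈ {a, b, c}` with `c ≤ 2n` (if `c` is even, `a`, `b` are odd), all prime
factors of `n` are odd, so `n ≤ rad(abc)^{T(E)}` and
`log c ≤ log 2 + T(E) log rad ≤ log 2 + C_δ (2¹⁰ rad)^δ · rad^δ / δ ≤ κ rad^ε` (`δ = ε/2`,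
`log x ≤ x^δ/δ`).
-/

-- `Summit.<Summit>.<Problem>` is the mandated summit-side namespace (CONVENTIONS §2); for the
-- single-conjunct summit `ABC` the two coincide, so the duplicate `ABC.ABC` is deliberate.
set_option linter.dupNamespace false

namespace Summit.ABC.ABC.Theorems

open Literature.NumberTheory.DiophantineGeometry Literature.NumberTheory.EllipticCurves
open WeierstrassCurve IsDedekindDomain Rat.HeightOneSpectrum UniqueFactorizationMonoid

/-! ### Elementary arithmetic of abc triples -/

/-- An abc triple has an odd member `n ∈ {a, b, c}` with `c ≤ 2n` (namely `c` if it is odd, and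
`max(a, b)` otherwise, `a` and `b` being then odd by coprimality); in particular `n ∣ abc`.
`[folklore]` -/
theorem SubexpABCManyPrimes.exists_odd_member {a b c : ℕ} (h : IsABCTriple a b c) :
    ∃ n : ℕ, 0 < n ∧ ¬ 2 ∣ n ∧ n ∣ a * b * c ∧ c ≤ 2 * n := by
  obtain ⟨ha, hb, habc, hcop⟩ := h
  by_cases hc2 : 2 ∣ c
  · have hodd : ¬ 2 ∣ a ∧ ¬ 2 ∣ b := by
      by_contra hcon
      have h2 : 2 ∣ a ∧ 2 ∣ b := by omega
      have hg := Nat.dvd_gcd h2.1 h2.2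
      rw [hcop.gcd_eq_one] at hg
      omega
    rcases le_total a b with hab | hab
    · exact ⟨b, hb, hodd.2, ⟨a * c, by ring⟩, by omega⟩
    · exact ⟨a, ha, hodd.1, ⟨b * c, by ring⟩, by omega⟩
  · exact ⟨c, by omega, hc2, ⟨a * b, by ring⟩, by omega⟩

/-- If `n ∣ m ≠ 0` and `v_q(n) ≤ T` for every prime `q ∣ n`, then `n ≤ rad(m)^T`: indeed
`n = ∏_{q ∣ n} q^{v_q(n)} ≤ (∏_{q ∣ n} q)^T ≤ rad(m)^T`. `[folklore]` -/
theorem SubexpABCManyPrimes.le_radical_pow {n m T : ℕ} (hn : 0 < n) (hm : m ≠ 0) (hnm : n ∣ m)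
    (hT : ∀ q : ℕ, q.Prime → q ∣ n → n.factorization q ≤ T) :
    n ≤ radical m ^ T := by
  have h1 : ∏ q ∈ n.primeFactors, q ^ n.factorization q = n := by
    rw [← Nat.support_factorization]
    exact Nat.prod_factorization_pow_eq_self hn.ne'
  calc n = ∏ q ∈ n.primeFactors, q ^ n.factorization q := h1.symm
    _ ≤ ∏ q ∈ n.primeFactors, q ^ T := by
        refine Finset.prod_le_prod (fun q _ => Nat.zero_le _) (fun q hq => ?_)
        have hqp := Nat.prime_of_mem_primeFactors hq
        exact Nat.pow_le_pow_right hqp.pos (hT q hqp (Nat.dvd_of_mem_primeFactors hq))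
    _ = (∏ q ∈ n.primeFactors, q) ^ T := Finset.prod_pow n.primeFactors T (fun q => q)
    _ ≤ radical m ^ T := by
        apply Nat.pow_le_pow_left
        rw [Nat.radical_eq_prod_primeFactors]
        exact Nat.le_of_dvd (Finset.prod_pos fun q hq => (Nat.prime_of_mem_primeFactors hq).pos)
          (Finset.prod_dvd_prod_of_subset _ _ _ (Nat.primeFactors_mono hnm hm))

/-! ### The Frey datum of an abc triple -/

/-- **Frey datum** (Bombieri–Gubler, *Heights*, Ex. 12.5.10, packaged for glue A). Every abc triple
carries a global minimal Weierstrass equation `W₀ / ℤ` of a Frey curve — (12.17) with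
`(A, B) = (a, b)` if `16 ∤ abc`, (12.18) for the arrangement of `exists_arrangement` if
`16 ∣ abc` — such that: `N ∣ 2¹⁰ rad(abc)`; every odd prime `p ∣ abc` divides `Δ(W₀)` and not
`c₄(W₀)` (multiplicative reduction); and `v_p(abc) ≤ v_p(|Δ(W₀)|)` for every odd prime `p`
(`|Δ(W₀)| = 16 (abc)²`, resp. `(abc/16)²`). [cite: BombieriGubler2006, Ex. 12.5.10] -/
theorem SubexpABCManyPrimes.exists_frey_datum {a b c : ℕ} (h : IsABCTriple a b c) :
    ∃ W₀ : WeierstrassCurve ℤ, (W₀.baseChange ℚ).IsElliptic ∧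
      (∀ v : HeightOneSpectrum ℤ, (W₀.baseChange ℚ).IsMinimalAt v) ∧
      (W₀.baseChange ℚ).conductorNorm ℤ ∣ 2 ^ 10 * rad a b c ∧
      (∀ p : ℕ, p.Prime → p ≠ 2 → p ∣ a * b * c → (p : ℤ) ∣ W₀.Δ ∧ ¬ (p : ℤ) ∣ W₀.c₄) ∧
      (∀ p : ℕ, p.Prime → p ≠ 2 → (a * b * c).factorization p ≤ W₀.Δ.natAbs.factorization p) := by
  have h' := h
  obtain ⟨ha, hb, habc, hcop⟩ := h'
  have hc : 0 < c := by omega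
  have habc0 : a * b * c ≠ 0 := by positivity
  by_cases h16 : 16 ∣ a * b * c
  · -- (12.18) for the arrangement `A ≡ -1 (mod 4)`, `16 ∣ B`
    obtain ⟨A, B, hAB, hA, hB, hprod, -⟩ := exists_arrangement h h16
    have h0 : A * B * (A + B) ≠ 0 := by
      rw [← Int.natAbs_ne_zero, hprod]; exact habc0
    have h4 : 4 ∣ B - A - 1 := by
      have : B - A - 1 = B - (A + 1) := by ring
      rw [this]; exact dvd_sub (dvd_trans (by norm_num) hB) hA
    have h16' : 16 ∣ A * B := dvd_mul_of_dvd_right hB _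
    obtain ⟨e, he⟩ := id h16'
    have he' : A * B / 16 = e := by rw [he]; simp
    have hfac : A * B * (A + B) = 16 * (e * (A + B)) := by rw [he]; ring
    refine ⟨freyIntModel₂ A B, isElliptic_freyIntModel₂ h0 h4 h16',
      isMinimalAt_freyIntModel₂ hAB hA hB, ?_, ?_, ?_⟩
    · rw [rad_def, ← hprod]
      exact (conductorNorm_freyIntModel₂_dvd hAB h0 hA hB).trans (dvd_mul_left _ _)
    · intro p hp hp2 hpdvd
      have hpint : Prime (p : ℤ) := Nat.prime_iff_prime_int.mp hp
      have hpm : (p : ℤ) ∣ A * B * (A + B) := by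
        rw [← Int.dvd_natAbs, hprod]; exact_mod_cast hpdvd
      refine ⟨?_, ?_⟩
      · rw [freyIntModel₂_Δ h4 h16', he']
        have h1 : (p : ℤ) ∣ e * (A + B) := by
          rw [hfac] at hpm
          rcases hpint.dvd_or_dvd hpm with h2 | h2
          · exact absurd (eq_two_of_dvd_sixteen hp h2) hp2
          · exact h2
        rw [show e ^ 2 * (A + B) ^ 2 = (e * (A + B)) ^ 2 by ring]
        exact dvd_pow h1 two_ne_zero
      · rw [freyIntModel₂_c₄ h4 h16']
        exact not_dvd_sq_add_mul_add_sq hAB hp hpm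
    · intro p hp hp2
      set k : ℕ := (e * (A + B)).natAbs with hkdef
      have hk : a * b * c = 16 * k := by
        rw [← hprod, hfac, Int.natAbs_mul]
        rfl
      have hΔ : (freyIntModel₂ A B).Δ.natAbs = k ^ 2 := by
        rw [freyIntModel₂_Δ h4 h16', he', show e ^ 2 * (A + B) ^ 2 = (e * (A + B)) ^ 2 by ring,
          Int.natAbs_pow]
      have hk0 : k ≠ 0 := by
        intro hk0
        apply habc0
        rw [hk, hk0]
      have h16p : (16 : ℕ).factorization p = 0 := by
        apply Nat.factorization_eq_zero_of_not_dvd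
        intro hd
        have h24 : p ∣ 2 ^ 4 := by norm_num; exact hd
        exact hp2 ((Nat.prime_dvd_prime_iff_eq hp Nat.prime_two).mp (hp.dvd_of_dvd_pow h24))
      rw [hk, hΔ, Nat.factorization_mul (by norm_num) hk0, Nat.factorization_pow, Finsupp.add_apply,
        Finsupp.smul_apply, h16p, zero_add, smul_eq_mul]
      omega
  · -- (12.17) with `(A, B) = (a, b)`
    have hab : IsCoprime (a : ℤ) (b : ℤ) := Nat.isCoprime_iff_coprime.mpr hcop
    have hP : (a : ℤ) * b * (a + b) = ((a * b * c : ℕ) : ℤ) := by rw [← habc]; push_cast; ring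
    have h0 : (a : ℤ) * b * (a + b) ≠ 0 := by rw [hP]; exact_mod_cast habc0
    have h16' : ¬ (16 : ℤ) ∣ (a : ℤ) * b * (a + b) := by
      rw [hP]; exact_mod_cast mt Int.natCast_dvd_natCast.mp h16
    refine ⟨freyIntModel a b, isElliptic_freyIntModel h0, isMinimalAt_freyIntModel hab h0 h16',
      ?_, ?_, ?_⟩
    · have := conductorNorm_freyIntModel_dvd hab h0 h16'
      rwa [hP, Int.natAbs_natCast, ← rad_def] at this
    · intro p hp hp2 hpdvd
      have hpint : Prime (p : ℤ) := Nat.prime_iff_prime_int.mp hp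
      have hpm : (p : ℤ) ∣ (a : ℤ) * b * (a + b) := by rw [hP]; exact_mod_cast hpdvd
      refine ⟨?_, ?_⟩
      · rw [freyIntModel_Δ]
        exact dvd_mul_of_dvd_right (dvd_pow hpm two_ne_zero) _
      · rw [freyIntModel_c₄]
        intro hd
        rcases hpint.dvd_or_dvd hd with hd | hd
        · exact hp2 (eq_two_of_dvd_sixteen hp hd)
        · exact not_dvd_sq_add_mul_add_sq hab hp hpm hd
    · intro p hp _hp2
      have hΔ : (freyIntModel (a : ℤ) b).Δ.natAbs = 16 * (a * b * c) ^ 2 := by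
        rw [freyIntModel_Δ, hP, Int.natAbs_mul, Int.natAbs_pow, Int.natAbs_natCast]
        rfl
      rw [hΔ]
      have hdvd : a * b * c ∣ 16 * (a * b * c) ^ 2 := ⟨16 * (a * b * c), by ring⟩
      exact (Finsupp.le_def.mp ((Nat.factorization_le_iff_dvd habc0 (by positivity)).mpr hdvd)) p

/-! ### Conductor exponents of a global minimal equation over `ℤ`, prime by prime -/

/-- For an integral equation `W₀ / ℤ` (elliptic over `ℚ`) minimal at every prime:
`v_p(N) = f_p ≤ v_p(|Δ(W₀)|)` for every prime `p` (`N = ∏ p^{f_p}` and `p^{f_p} ∣ Δ(W₀)`,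
Bombieri–Gubler 12.5.9(d)). `[folklore]` -/
theorem SubexpABCManyPrimes.factorization_conductorNorm_le (W₀ : WeierstrassCurve ℤ)
    [(W₀.baseChange ℚ).IsElliptic]
    (hmin : ∀ v : HeightOneSpectrum ℤ, (W₀.baseChange ℚ).IsMinimalAt v)
    {p : ℕ} (hp : p.Prime) :
    ((W₀.baseChange ℚ).conductorNorm ℤ).factorization p ≤ W₀.Δ.natAbs.factorization p := by
  have hΔ0 : W₀.Δ ≠ 0 := Δ_ne_zero_of_isElliptic_baseChange_int W₀
  have hv : natGenerator ((primesEquiv (R := ℤ)).symm ⟨p, hp⟩) = p :=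
    Literature.NumberTheory.EllipticCurves.Rat.natGenerator_primesEquiv_symm ⟨p, hp⟩
  have h2 := pow_conductorExponent_dvd_Δ (hmin ((primesEquiv (R := ℤ)).symm ⟨p, hp⟩))
  rw [hv] at h2
  rw [factorization_conductorNorm_primesEquiv_symm (W₀.baseChange ℚ) ⟨p, hp⟩]
  refine (hp.pow_dvd_iff_le_factorization (Int.natAbs_ne_zero.mpr hΔ0)).mp ?_
  rw [← Int.natCast_dvd]
  exact_mod_cast h2

/-- For an integral equation `W₀ / ℤ` (elliptic over `ℚ`) minimal at every prime: a prime `p`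
with `p ∣ Δ(W₀)`, `p ∤ c₄(W₀)` is a multiplicative prime, `v_p(N) = f_p = 1`
(Bombieri–Gubler 12.5.9(b) with 12.5.5). `[folklore]` -/
theorem SubexpABCManyPrimes.factorization_conductorNorm_eq_one (W₀ : WeierstrassCurve ℤ)
    [(W₀.baseChange ℚ).IsElliptic]
    (hmin : ∀ v : HeightOneSpectrum ℤ, (W₀.baseChange ℚ).IsMinimalAt v)
    {p : ℕ} (hp : p.Prime) (hΔ : (p : ℤ) ∣ W₀.Δ) (hc₄ : ¬ (p : ℤ) ∣ W₀.c₄) :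
    ((W₀.baseChange ℚ).conductorNorm ℤ).factorization p = 1 := by
  have hv : natGenerator ((primesEquiv (R := ℤ)).symm ⟨p, hp⟩) = p :=
    Literature.NumberTheory.EllipticCurves.Rat.natGenerator_primesEquiv_symm ⟨p, hp⟩
  rw [factorization_conductorNorm_primesEquiv_symm (W₀.baseChange ℚ) ⟨p, hp⟩]
  exact conductorExponent_eq_one_of_dvd_Δ_of_not_dvd_c₄
    (hmin ((primesEquiv (R := ℤ)).symm ⟨p, hp⟩)) (by rw [hv]; exact hΔ) (by rw [hv]; exact hc₄)

/-! ### The valuations of an abc triple are bounded by `T(E)` of its Frey curve -/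

/-- **Frey translation for glue A.** Given the many-prime valuation-product bound (crux r2 of the
route) at exponent `δ` with constant `C`, every abc triple with `ω(abc) ≥ 5` has an odd member
`n` (`n ∣ abc`, `c ≤ 2n`) with `n ≤ rad(abc)^T` for some natural number
`T ≤ C · (2¹⁰ rad(abc))^δ` (namely `T = T(E)` of the triple's minimal Frey model).
[cite: BombieriGubler2006, Ex. 12.5.10] -/
theorem SubexpABCManyPrimes.exists_member_le_pow {C δ : ℝ} (hδ : 0 ≤ δ)
    (hC : ∀ (W : WeierstrassCurve ℚ) [W.IsElliptic],
      (∀ p : ℕ, p.Prime → p ≠ 2 → ¬ p ^ 2 ∣ W.conductorNorm ℤ) →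
      4 ≤ ((W.conductorNorm ℤ).primeFactors.filter
        (fun p => p ≠ 2 ∧ ¬ p ^ 2 ∣ W.conductorNorm ℤ)).card →
      ((∏ p ∈ (W.conductorNorm ℤ).primeFactors with ¬ p ^ 2 ∣ W.conductorNorm ℤ,
        (W.minimalDiscriminantNorm ℤ).factorization p : ℕ) : ℝ) ≤ C * (W.conductorNorm ℤ : ℝ) ^ δ)
    {a b c : ℕ} (habc : IsABCTriple a b c) (hω : 5 ≤ (a * b * c).primeFactors.card) :
    ∃ n T : ℕ, 0 < n ∧ c ≤ 2 * n ∧ n ≤ rad a b c ^ T ∧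
      (T : ℝ) ≤ C * ((2 : ℝ) ^ 10 * (rad a b c : ℝ)) ^ δ := by
  obtain ⟨W₀, hE, hmin, hN, hloc, hval⟩ := SubexpABCManyPrimes.exists_frey_datum habc
  haveI := hE
  obtain ⟨ha, hb, hsum, hcop⟩ := habc
  have habc0 : a * b * c ≠ 0 := by
    have hc : 0 < c := by omega
    positivity
  set N : ℕ := (W₀.baseChange ℚ).conductorNorm ℤ with hNdef
  have hN0 : N ≠ 0 := (conductorNorm_pos_holds (W₀.baseChange ℚ)).ne'
  have hrad0 : rad a b c ≠ 0 := by rw [rad_def]; exact radical_ne_zero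
  have hsqf : Squarefree (rad a b c) := by rw [rad_def]; exact squarefree_radical
  -- (i) semistable away from `2`
  have hsemi : ∀ p : ℕ, p.Prime → p ≠ 2 → ¬ p ^ 2 ∣ N := by
    intro p hp hp2 hdvd
    have hpc : Nat.Coprime (p ^ 2) (2 ^ 10) :=
      Nat.Coprime.pow 2 10 ((Nat.coprime_primes hp Nat.prime_two).mpr hp2)
    have h2 : p ^ 2 ∣ rad a b c := hpc.dvd_of_dvd_mul_left (hdvd.trans hN)
    rw [sq] at h2
    exact hp.one_lt.ne' (Nat.isUnit_iff.mp (hsqf p h2))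
  -- (ii) `N.factorization p = f_p ≤ v_p(D)`, `D = |Δ(W₀)| = |Δ_min|`
  have hΔ0 : W₀.Δ ≠ 0 := Δ_ne_zero_of_isElliptic_baseChange_int W₀
  set D : ℕ := W₀.Δ.natAbs with hDdef
  have hD0 : D ≠ 0 := Int.natAbs_ne_zero.mpr hΔ0
  have hDmin : (W₀.baseChange ℚ).minimalDiscriminantNorm ℤ = D :=
    minimalDiscriminantNorm_eq_natAbs_holds W₀ hΔ0 hmin
  have hfac : ∀ p : ℕ, p.Prime → N.factorization p ≤ D.factorization p := fun p hp =>
    SubexpABCManyPrimes.factorization_conductorNorm_le W₀ hmin hp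
  -- (iii) odd primes of `abc` are multiplicative: `f_p = 1`
  have hmult : ∀ p : ℕ, p.Prime → p ≠ 2 → p ∣ a * b * c → N.factorization p = 1 := by
    intro p hp hp2 hpd
    obtain ⟨hΔ, hc₄⟩ := hloc p hp hp2 hpd
    exact SubexpABCManyPrimes.factorization_conductorNorm_eq_one W₀ hmin hp hΔ hc₄
  have hmemN : ∀ p : ℕ, p.Prime → p ≠ 2 → p ∣ a * b * c → p ∈ N.primeFactors := by
    intro p hp hp2 hpd
    rw [Nat.mem_primeFactors]
    exact ⟨hp, (hp.dvd_iff_one_le_factorization hN0).mpr (hmult p hp hp2 hpd).ge, hN0⟩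
  -- (iv) the cardinality hypothesis of r2
  have hcard : 4 ≤ (N.primeFactors.filter (fun p => p ≠ 2 ∧ ¬ p ^ 2 ∣ N)).card := by
    have hsub : (a * b * c).primeFactors.erase 2 ⊆
        N.primeFactors.filter (fun p => p ≠ 2 ∧ ¬ p ^ 2 ∣ N) := by
      intro p hp
      rw [Finset.mem_erase] at hp
      obtain ⟨hp2, hp⟩ := hp
      have hpp := Nat.prime_of_mem_primeFactors hp
      rw [Finset.mem_filter]
      exact ⟨hmemN p hpp hp2 (Nat.dvd_of_mem_primeFactors hp), hp2, hsemi p hpp hp2⟩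
    calc 4 ≤ (a * b * c).primeFactors.card - 1 := by omega
      _ ≤ ((a * b * c).primeFactors.erase 2).card := Finset.pred_card_le_card_erase
      _ ≤ _ := Finset.card_le_card hsub
  -- (v) apply r2 to the Frey curve
  have key := hC (W₀.baseChange ℚ) hsemi hcard
  rw [hDmin] at key
  set S := N.primeFactors.filter (fun p => ¬ p ^ 2 ∣ N) with hSdef
  set T : ℕ := ∏ p ∈ S, D.factorization p with hTdef
  have hfacS : ∀ p ∈ S, 1 ≤ D.factorization p := by
    intro p hp
    rw [hSdef, Finset.mem_filter] at hp
    have hpp := Nat.prime_of_mem_primeFactors hp.1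
    calc 1 ≤ N.factorization p :=
          (hpp.dvd_iff_one_le_factorization hN0).mp (Nat.dvd_of_mem_primeFactors hp.1)
      _ ≤ D.factorization p := hfac p hpp
  have hTpos : 0 < T := Finset.prod_pos fun p hp => hfacS p hp
  have hvalT : ∀ q : ℕ, q.Prime → q ≠ 2 → q ∣ a * b * c → (a * b * c).factorization q ≤ T := by
    intro q hq hq2 hqd
    have hqS : q ∈ S := by
      rw [hSdef, Finset.mem_filter]
      exact ⟨hmemN q hq hq2 hqd, hsemi q hq hq2⟩
    calc (a * b * c).factorization q ≤ D.factorization q := hval q hq hq2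
      _ ≤ T := Nat.le_of_dvd hTpos (Finset.dvd_prod_of_mem _ hqS)
  -- (vi) the odd member
  obtain ⟨n, hn0, hnodd, hndvd, hcn⟩ :=
    SubexpABCManyPrimes.exists_odd_member (⟨ha, hb, hsum, hcop⟩ : IsABCTriple a b c)
  have hnle : n ≤ rad a b c ^ T := by
    rw [rad_def]
    refine SubexpABCManyPrimes.le_radical_pow hn0 habc0 hndvd fun q hq hqn => ?_
    have hq2 : q ≠ 2 := by rintro rfl; exact hnodd hqn
    calc n.factorization q ≤ (a * b * c).factorization q :=
          (Finsupp.le_def.mp ((Nat.factorization_le_iff_dvd hn0.ne' habc0).mpr hndvd)) q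
      _ ≤ T := hvalT q hq hq2 (hqn.trans hndvd)
  -- (vii) `T ≤ C N^δ ≤ C (2^10 rad)^δ` (`1 ≤ T` and the r2 bound force `0 ≤ C`)
  have hNle : (N : ℝ) ≤ 2 ^ 10 * (rad a b c : ℝ) := by
    have := Nat.le_of_dvd (by positivity) hN
    exact_mod_cast this
  have hkey : (T : ℝ) ≤ C * (N : ℝ) ^ δ := by exact_mod_cast key
  refine ⟨n, T, hn0, hcn, hnle, hkey.trans ?_⟩
  have hT0 : (0 : ℝ) < T := by exact_mod_cast hTpos
  have hNpow : 0 < (N : ℝ) ^ δ :=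
    Real.rpow_pos_of_pos (by exact_mod_cast Nat.pos_of_ne_zero hN0) δ
  have hC0 : 0 ≤ C := by
    by_contra hC0
    push Not at hC0
    have : C * (N : ℝ) ^ δ < 0 := mul_neg_of_neg_of_pos hC0 hNpow
    linarith
  exact mul_le_mul_of_nonneg_left (Real.rpow_le_rpow (by positivity) hNle hδ) hC0

/-! ### Glue A: r2 ⟹ the milestone -/

/-- **Glue A of route `RibetTakahashiSplit`** (= the route decl
`SubexpManyPrimesOfValuationProduct`, item stmt-ABC-1570, unfolded): the many-prime valuation
product bound `ManyPrimeValuationProduct` (crux r2, stmt-ABC-1561) implies the milestone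
`SubexpABCManyPrimes` (stmt-ABC-1568) — for abc triples with `ω(abc) ≥ 5`,
`log c ≤ κ_ε · rad(abc)^ε`. With `δ = ε/2` and the Frey translation
`SubexpABCManyPrimes.exists_member_le_pow`: `log c ≤ log 2 + T log rad`,
`T ≤ C_δ (2¹⁰ rad)^δ`, `log rad ≤ rad^δ / δ`, so
`κ = log 2 + max(C_δ, 0) · 2^{10δ} / δ` works. The milestone itself (an unconditional
sub-exponential abc bound in the many-prime regime) stays open; this is the CONDITIONAL result
on the crux. The conclusion is the former route decl `…RibetTakahashiSplit.SubexpABCManyPrimes`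
(dropped by the items-cap autofix 2026-08-16) verbatim. [cite: BombieriGubler2006, Ex. 12.5.10] -/
theorem subexpManyPrimes_of_manyPrimeValuationProduct
    (h₂ : Summit.ABC.ABC.Theses.RibetTakahashiSplit.ManyPrimeValuationProduct) :
    ∀ ε : ℝ, 0 < ε → ∃ κ : ℝ, ∀ a b c : ℕ, IsABCTriple a b c → 5 ≤ (a * b * c).primeFactors.card →
      Real.log c ≤ κ * ((rad a b c : ℕ) : ℝ) ^ ε := by
  intro ε hε
  obtain ⟨δ, hδε, hδ⟩ : ∃ δ : ℝ, δ + δ = ε ∧ 0 < δ := ⟨ε / 2, add_halves ε, by positivity⟩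
  obtain ⟨C, hC⟩ := h₂ δ hδ
  obtain ⟨K, hK0, hKdef⟩ : ∃ K : ℝ, 0 ≤ K ∧ K = max C 0 * ((2 : ℝ) ^ 10) ^ δ / δ :=
    ⟨_, div_nonneg (mul_nonneg (le_max_right _ _) (Real.rpow_nonneg (by norm_num) _)) hδ.le, rfl⟩
  refine ⟨Real.log 2 + K, fun a b c habc hω => ?_⟩
  obtain ⟨n, T, hn0, hcn, hnle, hT⟩ :=
    SubexpABCManyPrimes.exists_member_le_pow hδ.le hC habc hω
  have hc0 : 0 < c := by obtain ⟨ha, -, hsum, -⟩ := habc; omega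
  have hrad0 : rad a b c ≠ 0 := by rw [rad_def]; exact radical_ne_zero
  have hR1 : (1 : ℝ) ≤ (rad a b c : ℝ) := by exact_mod_cast Nat.one_le_iff_ne_zero.mpr hrad0
  have hR0 : (0 : ℝ) < (rad a b c : ℝ) := one_pos.trans_le hR1
  have hlogR : 0 ≤ Real.log (rad a b c : ℝ) := Real.log_nonneg hR1
  -- `log c ≤ log 2 + log n ≤ log 2 + T log R`
  have h1 : Real.log c ≤ Real.log 2 + Real.log n := by
    rw [← Real.log_mul two_ne_zero (by exact_mod_cast hn0.ne')]
    exact Real.log_le_log (by exact_mod_cast hc0) (by exact_mod_cast hcn)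
  have h2 : Real.log n ≤ T * Real.log (rad a b c : ℝ) := by
    rw [← Real.log_pow]
    exact Real.log_le_log (by exact_mod_cast hn0) (by exact_mod_cast hnle)
  -- `T ≤ max(C,0) 2^{10δ} R^δ` and `log R ≤ R^δ / δ`
  have h3 : (T : ℝ) ≤ max C 0 * ((2 : ℝ) ^ 10) ^ δ * (rad a b c : ℝ) ^ δ := by
    calc (T : ℝ) ≤ C * ((2 : ℝ) ^ 10 * (rad a b c : ℝ)) ^ δ := hT
      _ ≤ max C 0 * ((2 : ℝ) ^ 10 * (rad a b c : ℝ)) ^ δ :=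
          mul_le_mul_of_nonneg_right (le_max_left _ _) (by positivity)
      _ = max C 0 * ((2 : ℝ) ^ 10) ^ δ * (rad a b c : ℝ) ^ δ := by
          rw [Real.mul_rpow (by positivity) hR0.le]; ring
  have h4 : Real.log (rad a b c : ℝ) ≤ (rad a b c : ℝ) ^ δ / δ := Real.log_le_rpow_div hR0.le hδ
  have h5 : (T : ℝ) * Real.log (rad a b c : ℝ) ≤ K * (rad a b c : ℝ) ^ ε := by
    calc (T : ℝ) * Real.log (rad a b c : ℝ)
          ≤ (max C 0 * ((2 : ℝ) ^ 10) ^ δ * (rad a b c : ℝ) ^ δ) * ((rad a b c : ℝ) ^ δ / δ) :=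
          mul_le_mul h3 h4 hlogR (by positivity)
      _ = K * ((rad a b c : ℝ) ^ δ * (rad a b c : ℝ) ^ δ) := by rw [hKdef]; ring
      _ = K * (rad a b c : ℝ) ^ ε := by rw [← Real.rpow_add hR0, hδε]
  have hRε : 1 ≤ (rad a b c : ℝ) ^ ε := Real.one_le_rpow hR1 hε.le
  have hlog2 : 0 ≤ Real.log 2 := Real.log_nonneg one_le_two
  have hT0 : (0 : ℝ) ≤ T := Nat.cast_nonneg T
  calc Real.log c ≤ Real.log 2 + T * Real.log (rad a b c : ℝ) := by linarith
    _ ≤ Real.log 2 * (rad a b c : ℝ) ^ ε + K * (rad a b c : ℝ) ^ ε := by nlinarith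
    _ = (Real.log 2 + K) * (rad a b c : ℝ) ^ ε := by ring

/-- Deprecated name of `subexpManyPrimes_of_manyPrimeValuationProduct` (its conclusion was the route
decl `…Theses.RibetTakahashiSplit.SubexpABCManyPrimes`, dropped 2026-08-16). [folklore] -/
@[deprecated subexpManyPrimes_of_manyPrimeValuationProduct (since := "2026-08-16")]
alias subexpABCManyPrimes_of_manyPrimeValuationProduct :=
  subexpManyPrimes_of_manyPrimeValuationProduct

/-- **Glue A as filed** (route decl `SubexpManyPrimesOfValuationProduct`, item stmt-ABC-1570):
`ManyPrimeValuationProduct → SubexpABCManyPrimes`, both sides unfolded in the route file; this is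
`subexpManyPrimes_of_manyPrimeValuationProduct` verbatim (the two types agree by `δ`-unfolding
the route's def). [cite: BombieriGubler2006, Ex. 12.5.10] -/
theorem subexpManyPrimesOfValuationProduct_proof :
    Summit.ABC.ABC.Theses.RibetTakahashiSplit.SubexpManyPrimesOfValuationProduct :=
  fun h₂ => subexpManyPrimes_of_manyPrimeValuationProduct h₂

end Summit.ABC.ABC.Theorems
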